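import Literature.NumberTheory.LFunctions.ConreyIwaniec2002Thm61ShiftedLimit
import Mathlib.Analysis.Calculus.MeanValue
import Mathlib.MeasureTheory.Integral.Bochner.ContinuousLinearMap
import HarnessLib

/-!
# Conrey–Iwaniec (2002), Theorem 6.1, (6.27)–(6.28): the evaluation of `S*(h)` (registered stub S2b)

B. Conrey, H. Iwaniec, *Spacing of zeros of Hecke `L`-functions and the class number problem*,
Acta Arith. 103 (2002) 259–312, §6 (6.27)–(6.28) [held text `paper:arxiv-math_0111012`, p0015:L52–92]:
"Next we replace `a(y+h)` in (6.27) by `a(y)` with the difference `O(Y²T⁻²h⁻¹|σ(h)|)`. We obtain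
`S*(h) = σ(h)∫|a(y)|²L(hT/y)dy + O(Bτ(h)(Y^{3/4} + Y²T⁻²h⁻¹ + T⁻²h)(log hY)⁴)` (6.28), where the
implied constant is absolute."

This file closes the registered sub-stub **S2b `stub_thm61_shifted : ∃ c : ℝ, 0 < c ∧ Thm61ShiftedSum c`**
of SKELETON P64 (line `thm61-cm-convolution`, cell `landau-siegel/ls-inputs`; interface
`Thm61ShiftedSum` of `ConreyIwaniec2002MeanValueDefs.lean`): `exists_thm61ShiftedSum`, statement
VERBATIM. Ingredients: (6.27) with the main term `σ(h)∫₀^∞a(x+h)ā(x)L(hT/x)dx`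
(`ConreyIwaniec2002Thm61ShiftedLimit.norm_sub_total_le`: (6.19) on the smooth `ρ`-adic partition of
unity, separated pieces trivially), the replacement `a(y+h) ↦ a(y)` by the mean value theorem
(`|a′(u)| ≤ u⁻¹(1+u/Y)⁻⁴`, `|L(v)| ≤ v⁻²`: `|∫(a(x+h)−a(x))ā(x)L| ≤ 2Y²/(hT²)`), and the bookkeeping
`|σ(h)| ≤ C₁σ₋₁(h) ≤ C₁τ(h)`, `log²(3Y) ≤ 4(1+log hY)⁴`, `(1+log 12h)³ ≤ 64(1+log hY)³`.

WHAT THIS IS NOT: Theorem 6.1 / Proposition 6.4 / Parity are not proved here — only the step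
(6.27)–(6.28), GENERIC in `λ`, `σ`, `B`. «The programme SEARCHES and TYPES; no claim about
Landau–Siegel zeros until a kernel theorem says so.»

## References
* [ConreyIwaniec2002] B. Conrey, H. Iwaniec, Acta Arith. 103 (2002) 259–312: §6 (6.14), (6.19),
  (6.20), (6.27)–(6.28).
-/

noncomputable section

open Set Filter MeasureTheory
open scoped Topology

namespace Literature.NumberTheory.LFunctions

namespace ConreyIwaniec2002

namespace Thm61ShiftedSum

open Thm61Partition Thm61Bumps Thm61ShiftedArith Thm61ShiftedPieces Thm61ShiftedLimit

section Main

variable {K : ℝ → ℝ} (hK : IsCIKernel K) {T Y : ℝ} {a : ℝ → ℂ} (hT : 1 ≤ T) (hY : 2 ≤ Y)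
  (ha : IsCutoff14 a Y) {h : ℕ} (hh : 1 ≤ h)

/-! ### The replacement `a(y+h) ↦ a(y)` -/

include hY ha in
/-- **Mean value step**: `‖a(x+h) − a(x)‖ ≤ h·x⁻¹(1+x/Y)⁻⁴` on `x > 0` (from `y|a′(y)| ≤ (1+y/Y)⁻⁴`,
non-increasing in `y`). [cite: ConreyIwaniec2002, §6 (6.14), (6.28)] -/
theorem norm_a_shift_sub_le {x : ℝ} (hx : 0 < x) (h : ℕ) :
    ‖a (x + h) - a x‖ ≤ h * (x⁻¹ * ((1 + x / Y) ^ 4)⁻¹) := by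
  have hY0 : 0 < Y := by linarith
  have h0 : (0:ℝ) ≤ h := Nat.cast_nonneg h
  have hdiff : ∀ y ∈ Icc x (x + h), DifferentiableAt ℝ a y := fun y hy =>
    (ha.1.differentiableOn (by simp)).differentiableAt (Ioi_mem_nhds (lt_of_lt_of_le hx hy.1))
  have hbound : ∀ y ∈ Icc x (x + h), ‖deriv a y‖ ≤ x⁻¹ * ((1 + x / Y) ^ 4)⁻¹ := by
    intro y hy
    have hy0 : 0 < y := lt_of_lt_of_le hx hy.1
    have h1 := ha.2 1 (by norm_num) y hy0
    rw [pow_one, iteratedDeriv_one] at h1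
    have hw : ((1 + y / Y) ^ 4)⁻¹ ≤ ((1 + x / Y) ^ 4)⁻¹ := by
      refine inv_anti₀ (by positivity) (pow_le_pow_left₀ (by positivity) ?_ 4)
      have := div_le_div_of_nonneg_right hy.1 hY0.le
      linarith
    calc ‖deriv a y‖ ≤ ((1 + y / Y) ^ 4)⁻¹ / y := by rw [le_div_iff₀ hy0, mul_comm]; exact h1
      _ ≤ ((1 + x / Y) ^ 4)⁻¹ / x := div_le_div₀ (by positivity) hw hx hy.1
      _ = x⁻¹ * ((1 + x / Y) ^ 4)⁻¹ := by rw [div_eq_mul_inv, mul_comm]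
  have hmv := (convex_Icc x (x + h)).norm_image_sub_le_of_norm_deriv_le hdiff hbound
    (left_mem_Icc.2 (by linarith)) (right_mem_Icc.2 (by linarith))
  rw [add_sub_cancel_left, Real.norm_of_nonneg h0] at hmv
  linarith

include hK hY ha in
/-- The diagonal integrand `|a(x)|²L(hT/x)` (as a complex function) is integrable on `(0,∞)`.
[cite: ConreyIwaniec2002, §6 (6.28)] -/
theorem integrable_diag :
    IntegrableOn (fun x : ℝ => (((‖a x‖ ^ 2 * ciL K (h * T / x) : ℝ)) : ℂ)) (Ioi 0) := by
  have hY0 : 0 < Y := by linarith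
  have hac : ContinuousOn a (Ioi 0) := ha.1.continuousOn
  have hcont : ContinuousOn (fun x : ℝ => (((‖a x‖ ^ 2 * ciL K (h * T / x) : ℝ)) : ℂ)) (Ioi 0) := by
    refine Complex.continuous_ofReal.comp_continuousOn ((hac.norm.pow 2).mul ?_)
    exact (Thm61OffDiagSeries.continuous_ciL hK).comp_continuousOn
      (continuousOn_const.div continuousOn_id fun x hx => ne_of_gt hx)
  set g : ℝ → ℂ := fun y => ((((1 + y / Y) ^ 4)⁻¹ : ℝ) : ℂ) with hg
  have hgb : ∀ y : ℝ, 0 < y → ‖g y‖ ≤ ((1 + y / Y) ^ 4)⁻¹ := fun y hy => by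
    rw [hg, Complex.norm_real, Real.norm_of_nonneg (by positivity)]
  have hgc : ContinuousOn g (Ioi 0) := by
    refine Complex.continuous_ofReal.comp_continuousOn (ContinuousOn.inv₀ (by fun_prop) ?_)
    intro y hy; have : (0:ℝ) < y := hy; positivity
  obtain ⟨hint, -⟩ := Thm61OffDiagSeries.integral_rpow_mul_normSq_g_le hY hgb hgc
    (c := 1) le_rfl (by norm_num)
  refine Integrable.mono' hint (hcont.aestronglyMeasurable measurableSet_Ioi) ?_
  refine (ae_restrict_iff' measurableSet_Ioi).2 (Eventually.of_forall fun x hx => ?_)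
  have hx0 : (0:ℝ) < x := hx
  have h1 := norm_a_le_weight ha hx0
  have h2 := Thm61OffDiagSeries.abs_ciL_le_one hK (h * T / x)
  rw [Complex.norm_real, Real.norm_eq_abs, abs_mul, abs_of_nonneg (sq_nonneg ‖a x‖), hg,
    Complex.norm_real, Real.norm_of_nonneg (by positivity), sub_self, Real.rpow_zero, one_mul]
  calc ‖a x‖ ^ 2 * |ciL K (h * T / x)| ≤ (((1 + x / Y) ^ 4)⁻¹) ^ 2 * 1 := by gcongr
    _ = _ := by rw [mul_one]

include hK hT hY ha hh in
/-- **(6.28), the replacement `a(y+h) ↦ a(y)`**: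
`|∫₀^∞ a(x+h)ā(x)L(hT/x)dx − ∫₀^∞ |a(y)|²L(hT/y)dy| ≤ 2Y²/(hT²)` (`|a(x+h)−a(x)| ≤ hx⁻¹(1+x/Y)⁻⁴`,
`|a| ≤ (1+x/Y)⁻⁴`, `|L(hT/x)| ≤ (x/hT)²`, `∫₀^∞ x(1+x/Y)⁻⁸dx ≤ 2Y²`).
[cite: ConreyIwaniec2002, §6 (6.28)] -/
theorem norm_integral_shift_sub_le :
    ‖(∫ x in Ioi (0:ℝ), a (x + h) * starRingEnd ℂ (a x) * (ciL K (h * T / x) : ℂ)) -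
        ((∫ y in Ioi (0:ℝ), ‖a y‖ ^ 2 * ciL K (h * T / y) : ℝ) : ℂ)‖ ≤ 2 * Y ^ 2 / (h * T ^ 2) := by
  have hY0 : 0 < Y := by linarith
  have hh0 : (0:ℝ) < h := by exact_mod_cast hh
  have hT0 : 0 < T := by linarith
  obtain ⟨-, hG⟩ := integrable_G hK hY ha (T := T) (h := h)
  have hH := integrable_diag hK hY ha (T := T) (h := h)
  rw [← integral_complex_ofReal, ← integral_sub hG hH]
  -- the majorant `(hT²)⁻¹ · x^{2-1}‖g(x)‖²`, `g = (1+x/Y)⁻⁴`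
  set g : ℝ → ℂ := fun y => ((((1 + y / Y) ^ 4)⁻¹ : ℝ) : ℂ) with hg
  have hgb : ∀ y : ℝ, 0 < y → ‖g y‖ ≤ ((1 + y / Y) ^ 4)⁻¹ := fun y hy => by
    rw [hg, Complex.norm_real, Real.norm_of_nonneg (by positivity)]
  have hgc : ContinuousOn g (Ioi 0) := by
    refine Complex.continuous_ofReal.comp_continuousOn (ContinuousOn.inv₀ (by fun_prop) ?_)
    intro y hy; have : (0:ℝ) < y := hy; positivity
  obtain ⟨hint, hval⟩ := Thm61OffDiagSeries.integral_rpow_mul_normSq_g_le hY hgb hgc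
    (c := 2) (by norm_num) (by norm_num)
  have hbd : ∀ x : ℝ, 0 < x →
      ‖a (x + h) * starRingEnd ℂ (a x) * (ciL K (h * T / x) : ℂ) -
          (((‖a x‖ ^ 2 * ciL K (h * T / x) : ℝ)) : ℂ)‖ ≤
        (h * T ^ 2)⁻¹ * (x ^ ((2:ℝ) - 1) * ‖g x‖ ^ 2) := by
    intro x hx
    have e : a (x + h) * starRingEnd ℂ (a x) * (ciL K (h * T / x) : ℂ) -
        (((‖a x‖ ^ 2 * ciL K (h * T / x) : ℝ)) : ℂ) =
        (a (x + h) - a x) * starRingEnd ℂ (a x) * (ciL K (h * T / x) : ℂ) := by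
      have : (((‖a x‖ ^ 2 : ℝ)) : ℂ) = a x * starRingEnd ℂ (a x) := by
        rw [Complex.mul_conj, Complex.normSq_eq_norm_sq]
      rw [Complex.ofReal_mul, this]; ring
    rw [e, norm_mul, norm_mul, Complex.norm_conj, Complex.norm_real, Real.norm_eq_abs]
    have h1 := norm_a_shift_sub_le hY ha hx h
    have h2 := norm_a_le_weight ha hx
    have h3 : |ciL K (h * T / x)| ≤ x ^ 2 / (h * T) ^ 2 := by
      have hv : 0 < h * T / x := by positivity
      refine (Thm61OffDiagSeries.abs_ciL_le_inv_sq hK hv).trans (le_of_eq ?_)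
      rw [div_pow, inv_div]
    have hgx : ‖g x‖ = ((1 + x / Y) ^ 4)⁻¹ := by
      rw [hg, Complex.norm_real, Real.norm_of_nonneg (by positivity)]
    have hx1 : x ^ ((2:ℝ) - 1) = x := by norm_num
    have hx' : x ≠ 0 := hx.ne'
    have hh' : (h : ℝ) ≠ 0 := hh0.ne'
    have hT' : T ≠ 0 := hT0.ne'
    have hw' : (1 + x / Y) ≠ 0 := by positivity
    calc ‖a (x + h) - a x‖ * ‖a x‖ * |ciL K (h * T / x)|
        ≤ (h * (x⁻¹ * ((1 + x / Y) ^ 4)⁻¹)) * ((1 + x / Y) ^ 4)⁻¹ * (x ^ 2 / (h * T) ^ 2) := by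
          gcongr
      _ = (h * T ^ 2)⁻¹ * (x ^ ((2:ℝ) - 1) * ‖g x‖ ^ 2) := by
          rw [hx1, hgx]; field_simp
  calc ‖∫ x in Ioi (0:ℝ), (a (x + h) * starRingEnd ℂ (a x) * (ciL K (h * T / x) : ℂ) -
          (((‖a x‖ ^ 2 * ciL K (h * T / x) : ℝ)) : ℂ))‖
      ≤ ∫ x in Ioi (0:ℝ), (h * T ^ 2)⁻¹ * (x ^ ((2:ℝ) - 1) * ‖g x‖ ^ 2) := by
        refine norm_integral_le_of_norm_le (hint.const_mul _) ?_
        exact (ae_restrict_iff' measurableSet_Ioi).2 (Eventually.of_forall fun x hx => hbd x hx)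
    _ = (h * T ^ 2)⁻¹ * ∫ x in Ioi (0:ℝ), x ^ ((2:ℝ) - 1) * ‖g x‖ ^ 2 := integral_const_mul _ _
    _ ≤ (h * T ^ 2)⁻¹ * (2 * Y ^ (2:ℝ)) := mul_le_mul_of_nonneg_left hval (by positivity)
    _ = 2 * Y ^ 2 / (h * T ^ 2) := by
        rw [Real.rpow_two]; field_simp

end Main

/-! ### The registered stub S2b -/

/-- The geometric constant `G₀ = ρ^{3/4}/(ρ^{3/4}−1) + (1−ρ^{−21/4})⁻¹` is positive (`ρ = 9/8`).
[cite: ConreyIwaniec2002, §6 (6.27)] -/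
theorem geomConst_pos :
    0 < (9 / 8 : ℝ) ^ (3 / 4 : ℝ) / ((9 / 8 : ℝ) ^ (3 / 4 : ℝ) - 1) +
      (1 - (9 / 8 : ℝ) ^ (-(21 / 4) : ℝ))⁻¹ := by
  have h1 : 1 < (9 / 8 : ℝ) ^ (3 / 4 : ℝ) := Real.one_lt_rpow (by norm_num) (by norm_num)
  have h2 : (9 / 8 : ℝ) ^ (-(21 / 4) : ℝ) < 1 :=
    Real.rpow_lt_one_of_one_lt_of_neg (by norm_num) (by norm_num)
  have h3 : 0 < (9 / 8 : ℝ) ^ (3 / 4 : ℝ) / ((9 / 8 : ℝ) ^ (3 / 4 : ℝ) - 1) :=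
    div_pos (by linarith) (by linarith)
  have h4 : 0 < (1 - (9 / 8 : ℝ) ^ (-(21 / 4) : ℝ))⁻¹ := inv_pos.2 (by linarith)
  linarith

/-- **S2b — (6.27)–(6.28): the evaluation of `S*(h)` from the shifted-convolution asymptotics
(6.19)** (registered sub-stub `stub_thm61_shifted` of SKELETON P64, interface `Thm61ShiftedSum` of
`ConreyIwaniec2002MeanValueDefs.lean`, statement verbatim): there is an absolute `c > 0` such that
for every admissible kernel `K`, `|λ| ≤ τ`, `|σ(h)| ≤ C₁σ₋₁(h)`, `ShiftedConvolutionBound λ σ B₁`,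
`a` in the class (6.14) with `a(0) = 0`, `T ≥ 1`, `Y ≥ 2`, `h ≥ 1`:
`|S*(h) − σ(h)∫₀^∞|a(y)|²L(hT/y)dy| ≤ cτ(h)[(1+B₁)Y^{3/4}(1+log hY)⁴ + (1+C₁)(Y²/(T²h) + h(1+log hY)³/T²)]`.
Proof: (6.19) on a smooth `9/8`-adic partition of unity in `m = n + h` (non-separated pieces),
trivial bounds for the separated pieces, Tannery / dominated convergence to sum the pieces, and the
mean-value replacement `a(y+h) ↦ a(y)`. [cite: ConreyIwaniec2002, §6 (6.27)–(6.28)] -/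
theorem _root_.Literature.NumberTheory.LFunctions.ConreyIwaniec2002.exists_thm61ShiftedSum :
    ∃ c : ℝ, 0 < c ∧ Thm61ShiftedSum c := by
  obtain ⟨D, hD1, hD⟩ := plateau_bounds (ρ := (9 / 8 : ℝ)) (by norm_num)
  have hρ : (9 / 8 : ℝ) = 9 / 8 := rfl
  have hGpos := geomConst_pos
  refine ⟨768 * ((9 / 8 : ℝ) ^ 2 * D * (1 + (9 / 8 : ℝ) ^ 8)) ^ 2 *
      ((9 / 8 : ℝ) ^ (3 / 4 : ℝ) / ((9 / 8 : ℝ) ^ (3 / 4 : ℝ) - 1) +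
        (1 - (9 / 8 : ℝ) ^ (-(21 / 4) : ℝ))⁻¹) + 100000,
    add_pos_of_nonneg_of_pos (mul_nonneg (by positivity) hGpos.le) (by norm_num), ?_⟩
  intro K hK lam σ B₁ C₁ hB₁ hC₁ hlam hσ hS T Y a hT hY ha ha0 h hh
  have hT0 : 0 < T := by linarith
  have hY0 : 0 < Y := by linarith
  have hh1 : (1:ℝ) ≤ h := by exact_mod_cast hh
  have hh0 : (0:ℝ) < h := by linarith
  -- (6.27) with the shifted main term, and (6.28)
  have h627 := norm_sub_total_le hρ hK hB₁ hS hlam hT hY ha ha0 hh hD1 hD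
  have h628 := norm_integral_shift_sub_le hK hT hY ha hh
  have hστ : |σ h| ≤ C₁ * (Nat.divisors h).card :=
    (hσ h hh).trans (mul_le_mul_of_nonneg_left (sum_divisors_inv_le_card h) hC₁)
  obtain ⟨hl12_0, hl12⟩ := one_add_log_twelve_mul_le hY hh
  have hlog3 := log_three_mul_sq_le hY hh
  -- abbreviations
  set P : ℝ := (9 / 8 : ℝ) ^ 2 * D * (1 + (9 / 8 : ℝ) ^ 8) with hP
  set G₀ : ℝ := (9 / 8 : ℝ) ^ (3 / 4 : ℝ) / ((9 / 8 : ℝ) ^ (3 / 4 : ℝ) - 1) +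
      (1 - (9 / 8 : ℝ) ^ (-(21 / 4) : ℝ))⁻¹ with hG₀
  set τ : ℝ := ((Nat.divisors h).card : ℝ) with hτ
  set Λ : ℝ := 1 + Real.log (h * Y) with hΛ
  have hD0 : 0 < D := by linarith
  have hP0 : 0 < P := by rw [hP]; positivity
  have hτ1 : 1 ≤ τ := by
    rw [hτ]; exact_mod_cast Finset.card_pos.2 ⟨1, Nat.one_mem_divisors.2 (by omega)⟩
  have hτ0 : 0 < τ := by linarith
  have hΛ1 : 1 ≤ Λ := by
    rw [hΛ]
    have : 0 ≤ Real.log (h * Y) := Real.log_nonneg (by nlinarith)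
    linarith
  have hΛ0 : 0 < Λ := by linarith
  -- the three target quantities
  set A : ℝ := τ * ((1 + B₁) * Y ^ (3 / 4 : ℝ) * Λ ^ 4) with hA
  set B : ℝ := τ * ((1 + C₁) * (Y ^ 2 / (T ^ 2 * h))) with hB
  set C : ℝ := τ * ((1 + C₁) * (h * Λ ^ 3 / T ^ 2)) with hC
  have hA0 : 0 ≤ A := by rw [hA]; positivity
  have hB0 : 0 ≤ B := by rw [hB]; positivity
  have hC0 : 0 ≤ C := by rw [hC]; positivity
  clear_value P G₀ τ Λ A B C
  have hτC : 1 ≤ τ * (1 + C₁) := one_le_mul_of_one_le_of_one_le hτ1 (by linarith)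
  -- (i) the separated block of the sum
  have h1 : 121 / T ^ 2 * (12 * h * (1 + Real.log (12 * h)) ^ 3) ≤ 92928 * C := by
    have hl3 : (1 + Real.log (12 * h)) ^ 3 ≤ 64 * Λ ^ 3 := by
      calc (1 + Real.log (12 * h)) ^ 3 ≤ (4 * Λ) ^ 3 := pow_le_pow_left₀ hl12_0 hl12 3
        _ = 64 * Λ ^ 3 := by ring
    have h0 : 0 ≤ h * Λ ^ 3 / T ^ 2 := by positivity
    have hC' : h * Λ ^ 3 / T ^ 2 ≤ C := by
      have : 1 * (h * Λ ^ 3 / T ^ 2) ≤ (τ * (1 + C₁)) * (h * Λ ^ 3 / T ^ 2) :=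
        mul_le_mul_of_nonneg_right hτC h0
      rw [hC]; linarith
    calc 121 / T ^ 2 * (12 * h * (1 + Real.log (12 * h)) ^ 3)
        ≤ 121 / T ^ 2 * (12 * h * (64 * Λ ^ 3)) := by gcongr
      _ = 92928 * (h * Λ ^ 3 / T ^ 2) := by ring
      _ ≤ 92928 * C := by linarith
  -- (ii) the separated block of the integral
  have h2 : |σ h| * (121 / T ^ 2 * (11 * h)) ≤ 1331 * C := by
    have hΛ3 : 1 ≤ Λ ^ 3 := one_le_pow₀ hΛ1
    have h0 : 0 ≤ 121 / T ^ 2 * (11 * h) := by positivity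
    calc |σ h| * (121 / T ^ 2 * (11 * h)) ≤ (C₁ * τ) * (121 / T ^ 2 * (11 * h)) :=
          mul_le_mul_of_nonneg_right hστ h0
      _ = 1331 * (τ * C₁ * (h / T ^ 2)) * 1 := by ring
      _ ≤ 1331 * (τ * (1 + C₁) * (h / T ^ 2)) * Λ ^ 3 := by
          refine mul_le_mul ?_ hΛ3 zero_le_one (by positivity)
          have : τ * C₁ * (h / T ^ 2) ≤ τ * (1 + C₁) * (h / T ^ 2) := by
            refine mul_le_mul_of_nonneg_right (mul_le_mul_of_nonneg_left (by linarith) ?_)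
              (by positivity)
            linarith
          linarith
      _ = 1331 * C := by rw [hC]; ring
  -- (iii) the non-separated pieces
  have h3 : 192 * P ^ 2 * B₁ * τ * (G₀ * Y ^ (3 / 4 : ℝ) * Real.log (3 * Y) ^ 2) ≤
      768 * P ^ 2 * G₀ * A := by
    have hB' : B₁ ≤ 1 + B₁ := by linarith
    have e : 768 * P ^ 2 * G₀ * A =
        192 * P ^ 2 * (1 + B₁) * τ * (G₀ * Y ^ (3 / 4 : ℝ) * (4 * Λ ^ 4)) := by rw [hA]; ring
    rw [e]
    have hx : 0 ≤ 192 * P ^ 2 := by positivity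
    have hy : 0 ≤ G₀ * Y ^ (3 / 4 : ℝ) := by positivity
    calc 192 * P ^ 2 * B₁ * τ * (G₀ * Y ^ (3 / 4 : ℝ) * Real.log (3 * Y) ^ 2)
        = (192 * P ^ 2) * (B₁ * τ) * ((G₀ * Y ^ (3 / 4 : ℝ)) * Real.log (3 * Y) ^ 2) := by ring
      _ ≤ (192 * P ^ 2) * ((1 + B₁) * τ) * ((G₀ * Y ^ (3 / 4 : ℝ)) * (4 * Λ ^ 4)) := by
          refine mul_le_mul (mul_le_mul_of_nonneg_left
            (mul_le_mul_of_nonneg_right hB' (by linarith)) hx)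
            (mul_le_mul_of_nonneg_left hlog3 hy) (by positivity) (by positivity)
      _ = 192 * P ^ 2 * (1 + B₁) * τ * (G₀ * Y ^ (3 / 4 : ℝ) * (4 * Λ ^ 4)) := by ring
  -- (iv) the replacement `a(y+h) ↦ a(y)`
  have h4 : |σ h| * (2 * Y ^ 2 / (h * T ^ 2)) ≤ 2 * B := by
    have h0 : 0 ≤ 2 * Y ^ 2 / (h * T ^ 2) := by positivity
    calc |σ h| * (2 * Y ^ 2 / (h * T ^ 2)) ≤ (C₁ * τ) * (2 * Y ^ 2 / (h * T ^ 2)) :=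
          mul_le_mul_of_nonneg_right hστ h0
      _ = 2 * (τ * (C₁ * (Y ^ 2 / (T ^ 2 * h)))) := by ring
      _ ≤ 2 * (τ * ((1 + C₁) * (Y ^ 2 / (T ^ 2 * h)))) := by
          have h5 : C₁ * (Y ^ 2 / (T ^ 2 * h)) ≤ (1 + C₁) * (Y ^ 2 / (T ^ 2 * h)) :=
            mul_le_mul_of_nonneg_right (by linarith) (by positivity)
          have h6 := mul_le_mul_of_nonneg_left h5 hτ0.le
          linarith
      _ = 2 * B := by rw [hB]
  -- assembly
  have hmain : ‖(∑' n : ℕ, lam (n + h) * a ((n : ℝ) + h) * starRingEnd ℂ (lam n * a n) *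
        (ciL K (h * T / n) : ℂ)) -
      (σ h : ℂ) * ((∫ y in Set.Ioi (0 : ℝ), ‖a y‖ ^ 2 * ciL K (h * T / y) : ℝ) : ℂ)‖ ≤
      92928 * C + 1331 * C + 768 * P ^ 2 * G₀ * A + 2 * B := by
    have hsplit : (∑' n : ℕ, lam (n + h) * a ((n : ℝ) + h) * starRingEnd ℂ (lam n * a n) *
          (ciL K (h * T / n) : ℂ)) -
        (σ h : ℂ) * ((∫ y in Set.Ioi (0 : ℝ), ‖a y‖ ^ 2 * ciL K (h * T / y) : ℝ) : ℂ) =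
        ((∑' n : ℕ, lam (n + h) * a ((n : ℝ) + h) * starRingEnd ℂ (lam n * a n) *
            (ciL K (h * T / n) : ℂ)) -
          (σ h : ℂ) * ∫ x in Ioi (0:ℝ), a (x + h) * starRingEnd ℂ (a x) * (ciL K (h * T / x) : ℂ)) +
        (σ h : ℂ) * ((∫ x in Ioi (0:ℝ), a (x + h) * starRingEnd ℂ (a x) * (ciL K (h * T / x) : ℂ)) -
          ((∫ y in Set.Ioi (0 : ℝ), ‖a y‖ ^ 2 * ciL K (h * T / y) : ℝ) : ℂ)) := by ring
    rw [hsplit]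
    refine (norm_add_le _ _).trans ?_
    have hsecond : ‖(σ h : ℂ) * ((∫ x in Ioi (0:ℝ), a (x + h) * starRingEnd ℂ (a x) *
          (ciL K (h * T / x) : ℂ)) -
        ((∫ y in Set.Ioi (0 : ℝ), ‖a y‖ ^ 2 * ciL K (h * T / y) : ℝ) : ℂ))‖ ≤
        |σ h| * (2 * Y ^ 2 / (h * T ^ 2)) := by
      rw [norm_mul, Complex.norm_real, Real.norm_eq_abs]
      exact mul_le_mul_of_nonneg_left h628 (abs_nonneg _)
    linarith [h627, hsecond, h1, h2, h3, h4]
  have hPG : 0 ≤ P ^ 2 * G₀ := by positivity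
  have key : 92928 * C + 1331 * C + 768 * P ^ 2 * G₀ * A + 2 * B ≤
      (768 * P ^ 2 * G₀ + 100000) * (A + B + C) := by
    have expand : (768 * P ^ 2 * G₀ + 100000) * (A + B + C) =
        (92928 * C + 1331 * C + 768 * P ^ 2 * G₀ * A + 2 * B) +
          (768 * (P ^ 2 * G₀ * B) + 768 * (P ^ 2 * G₀ * C) + 100000 * A + 99998 * B +
            5741 * C) := by ring
    rw [expand]
    have hB' := mul_nonneg hPG hB0
    have hC' := mul_nonneg hPG hC0
    linarith
  have e : (768 * P ^ 2 * G₀ + 100000) * (A + B + C) =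
      (768 * P ^ 2 * G₀ + 100000) * τ * ((1 + B₁) * Y ^ (3 / 4 : ℝ) * Λ ^ 4 +
        (1 + C₁) * (Y ^ 2 / (T ^ 2 * h) + h * Λ ^ 3 / T ^ 2)) := by
    rw [hA, hB, hC]; ring
  exact hmain.trans (key.trans e.le)

end Thm61ShiftedSum

end ConreyIwaniec2002

end Literature.NumberTheory.LFunctions

end
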